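import Summits.BirchSwinnertonDyer.BirchSwinnertonDyer.Theorems.ByReductionTypeAtTwoAdditiveGammaTwistKernel
import HarnessLib

/-!
# Route ByReductionTypeAtTwo, crux C4″ `AdditivePotMultOverKAtTwo` (stmt-BirchSwinnertonDyer-22618; parent 19098) — reading
# R15 IN THE KERNEL, the CONVERSE transport: `KatoOddBranchInputsAtTwoNegTwoSplitTwistPrintExact ⟹
# KatoOddBranchInputsAtTwoNegOneSplitTwistPrintExact`, hence the two typed odd-branch inputs of C4″'s split-twist blocks
# are ONE object (`… ↔ …`)

Cell `bsd-2adic`, seat `bsd-2adic-k4-w3` GEN 3. `W ↦ W^{(2)}` is an involution on `ℚ`-isomorphism classes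
(`(W^{(2)})^{(2)} = W^{(4)} ≅ W`) EXCHANGING the `(−1)`- and `(−2)`-split-twist blocks (GEN 0 R15), and
`Tw = unitTwist · (−1) : (1+T) ↦ −(1+T)` is an involution of `Λ = ℤ₂⟦T⟧` (`Tw ∘ Tw = id`, `Tw(5T+4) = −(5T+6)`,
`Tw(5T+6) = −(5T+4)`); so the transport of the sequel's prequel (`…GammaTwistKernel`:
`KatoOddBranchInputsAtTwoNegOneSplitTwistPrintExact ⟹ …NegTwo…`) runs backwards with the same kernel pieces:

* §1 `unitTwist_neg_one_five_X_add_six` — `Tw(5T+6) = −(5T+4)`; `negOnePackage_of_negTwoPackage_of_twTransport` — POINTWISE,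
  the mirror image of GEN 2's `negTwoPackage_of_negOnePackage_of_twTransport`: for `W` with `W^{(−1)}` split multiplicative at
  `2`, `f` its newform, any `W₂` (intended: a minimal model of `W^{(2)}`, a `(−2)`-block curve), the `(−2)`-block print-exact
  package at `(W₂, f)` (`L = (5T+6)^ℚ·L⁻_2(f,1,ωχ₂)`) and `Tw`-identifications of the Kato carriers of `W` with those of `W₂`
  give the `(−1)`-block package at `(W, f)` (`L = (5T+4)^ℚ·L⁻_2(f,1,ω)`) — Literature
  `Kato2004.exists_multDivisibilityInputsContra_of_semilinear_sideConditions` with `θ = Tw` and the BACKWARD analytic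
  transport `unitTwist_transport_of_split … .2` (MTT §I.13).
* §2 `exists_negTwoAvatar_of_quadraticTwist_two` — every elliptic `W/ℚ` has a globally minimal model `W₂` of `W^{(2)}` with
  `W₂^{(−2)} ≅_ℚ W^{(−4)} ≅_ℚ W^{(−1)}`: split multiplicative at `2` ⟺, `W₂[2]` irreducible ⟺ `W[2]` irreducible, a newform
  of `W^{(−1)}` is a newform of `W₂^{(−2)}`.
* §3 `twTransport_of_negOneSplitTwist` (the `(−2)`-block avatar of a `(−1)`-block curve with both carrier twins — this seat's
  `exists_iwasawaH1Data_negTwist_two` and t42 GEN 22's `AddSelmerTwistTwo.exists_twist_selmerDualData_two_inv`),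
  **`katoOddBranchInputsNegOnePrintExact_of_negTwo`** and **`katoOddBranchInputsNegOnePrintExact_iff_negTwo`**:
  `KatoOddBranchInputsAtTwoNegOneSplitTwistPrintExact ↔ KatoOddBranchInputsAtTwoNegTwoSplitTwistPrintExact`.

HONEST FRAMING (D-0036 / D-0054): theorems only — no definition, no named fact, no instance, no `sorry`; route-independent
(no `Theses` import); shrinks-literal (two typed research-grade inputs of C4″ are ONE); closes none; nothing booked; BSD is not
proved by any of this. PARTITION: X5@2 additive potentially-multiplicative block, `(−1)`/`(−2)`-split-twist sub-blocks × `p = 2`.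

References: [GreenbergLNM1716] §4 p. 107; [Rubin2000] Ch. VI §1–§2; [Kato2004Asterisque] Thm. 12.5 with (12.5.1) (p. 222),
§17.13 (pp. 279–280); [MazurTateTeitelbaum1986Invent] §I.13; [SilvermanAEC2009] X.2 Prop. 2.4, X.5 Cor. 5.4, VIII.8 Cor. 8.3.
-/

set_option autoImplicit false
-- the summit's namespace `Summit.BirchSwinnertonDyer.BirchSwinnertonDyer` (Sub = Summit) trips `dupNamespace`
set_option linter.dupNamespace false

noncomputable section

open scoped MatrixGroups ModularForm

open Field CongruenceSubgroup WeierstrassCurve Literature.NumberTheory.EllipticCurves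
  Literature.NumberTheory.EllipticCurves.ModularForms Literature.NumberTheory.EllipticCurves.PadicIntSeries
  Literature.NumberTheory.GaloisRepresentations

namespace Summit.BirchSwinnertonDyer.BirchSwinnertonDyer.Theorems.AddKatoTwoGammaTwist

open Summit.BirchSwinnertonDyer.BirchSwinnertonDyer.Theorems.PrintCf2.LayerNormCharIdeal (norm_neg_one_sub_one_lt_two)
open Summit.BirchSwinnertonDyer.BirchSwinnertonDyer.Theorems.AddKatoTwo
open Summit.BirchSwinnertonDyer.BirchSwinnertonDyer.Theorems.AddSelmerTwistTwo (exists_twist_selmerDualData_two_inv)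

/-! ## §1 `Tw(5T+6) = −(5T+4)` and the pointwise converse package transport -/

/-- **`Tw(5T + 6) = −(5T + 4)`**: the `(−2)`-block's exceptional prime polynomial goes back to the `(−1)`-block's under the
involution `Tw` (companion of `unitTwist_neg_one_five_X_add_four`). [cite: Kato2004Asterisque, Thm. 12.5 with (12.5.1) (p. 222)] -/
theorem unitTwist_neg_one_five_X_add_six :
    unitTwist (PowerSeries.C 5 * PowerSeries.X + PowerSeries.C 6 : IwasawaAlgebra 2) (-1) =
      -(PowerSeries.C 5 * PowerSeries.X + PowerSeries.C 4) := by
  rw [unitTwist_add _ _ norm_neg_one_sub_one_lt_two, unitTwist_mul _ _ norm_neg_one_sub_one_lt_two,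
    unitTwist_C _ norm_neg_one_sub_one_lt_two, unitTwist_C _ norm_neg_one_sub_one_lt_two, unitTwist_X_neg_one]
  have h : (PowerSeries.C (4 : ℤ_[2]) : IwasawaAlgebra 2) = PowerSeries.C 5 * PowerSeries.C 2 - PowerSeries.C 6 := by
    rw [← map_mul, ← map_sub]; norm_num
  rw [h]
  ring

/-- **R15 package transport, pointwise, CONVERSE direction.** `W/ℚ` with `W^{(−1)}` SPLIT multiplicative at `2`, `f` the
newform of `W^{(−1)}`, `W₂/ℚ` any curve (intended: a minimal model of `W^{(2)}`, for which `W₂^{(−2)} ≅ W^{(−1)}`), `(κ, γ)` the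
cyclotomic tower data. IF every print-exact §17.13 package of the `(−2)`-block shape holds at `(W₂, f)` (`L = (5T+6)^ℚ ·
L⁻_2(f,1,ωχ₂)`, Coleman cokernel of length `0` off `(2)`, `𝐇²_loc` of length `0` off `(2)` and off `(5T+6)`) AND every pair of
Kato carriers `(I, D')` of `W` is `Tw`-semilinearly identified with a pair `(I₂, D₂')` of `W₂`, THEN the `(−1)`-block shape holds
at `(W, f)` (`L = (5T+4)^ℚ · L⁻_2(f,1,ω)`, exceptional prime `5T+4`). Proof: the Literature transport
`Kato2004.exists_multDivisibilityInputsContra_of_semilinear_sideConditions` with `θ = Tw`, the backward analytic transport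
`unitTwist_transport_of_split … .2` (`(Tw G)^ℚ = 2ⁿ·(Tw(5T+6))^ℚ·L⁻`) and `Tw(5T+6) = −(5T+4)`.
[cite: GreenbergLNM1716, §4 (p. 107)] [cite: Rubin2000, Ch. VI §1–§2]
[cite: Kato2004Asterisque, Thm. 12.5 with (12.5.1) (p. 222), §17.13 (pp. 279–280)] [cite: MazurTateTeitelbaum1986Invent, §I.13] -/
theorem negOnePackage_of_negTwoPackage_of_twTransport
    (W : WeierstrassCurve ℚ) [W.IsElliptic] [ContinuousSMul ℤ_[2] (W.tateModule 2)]
    (W₂ : WeierstrassCurve ℚ) [W₂.IsElliptic] [ContinuousSMul ℤ_[2] (W₂.tateModule 2)]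
    {N : ℕ} [NeZero N] (f : CuspForm (Gamma0 N) 2) (κ : ZpExtension ℚ 2) (γ : absoluteGaloisGroup ℚ)
    (hsp : (W.quadraticTwist (-1)).HasSplitMultiplicativeReductionAtPrime 2) (hf : IsNewformOf (W.quadraticTwist (-1)) f)
    (hK₂ : ∀ (I₂ : Kato2004.IwasawaH1Data W₂ 2 κ γ) (D₂' : W₂.SelmerDualData κ γ⁻¹),
      ∃ K : Kato2004.MultDivisibilityInputsContra W₂ 2
          (iwasawaToPowerSeries 2 (PowerSeries.C 5 * PowerSeries.X + PowerSeries.C 6) *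
            padicLFunctionMinusBranchMultTwist f (1 : ℚ_[2]) 1 (-1)) κ γ I₂ D₂',
        (∀ 𝔮 : PrimeSpectrum (IwasawaAlgebra 2), 𝔮.asIdeal.height = 1 →
            PowerSeries.C (2 : ℤ_[2]) ∉ 𝔮.asIdeal →
            Module.lengthAt (IwasawaAlgebra 2) (IwasawaAlgebra 2 ⧸ LinearMap.range K.col) 𝔮 = 0) ∧
        (∀ 𝔮 : PrimeSpectrum (IwasawaAlgebra 2), 𝔮.asIdeal.height = 1 →
            PowerSeries.C (2 : ℤ_[2]) ∉ 𝔮.asIdeal →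
            𝔮.asIdeal ≠ Ideal.span {(PowerSeries.C 5 * PowerSeries.X + PowerSeries.C 6 : IwasawaAlgebra 2)} →
            Module.lengthAt (IwasawaAlgebra 2) K.H2loc 𝔮 = 0))
    (hTw : ∀ (I : Kato2004.IwasawaH1Data W 2 κ γ) (D' : W.SelmerDualData κ γ⁻¹),
      ∃ (I₂ : Kato2004.IwasawaH1Data W₂ 2 κ γ) (D₂' : W₂.SelmerDualData κ γ⁻¹)
        (eI : I₂.H ≃+ I.H) (eD : D₂'.X ≃+ D'.X),
        (∀ (r : IwasawaAlgebra 2) (h : I₂.H), eI (r • h) = unitTwist r (-1) • eI h) ∧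
        (∀ (r : IwasawaAlgebra 2) (x : D₂'.X), eD (r • x) = unitTwist r (-1) • eD x))
    (I : Kato2004.IwasawaH1Data W 2 κ γ) (D' : W.SelmerDualData κ γ⁻¹) :
    ∃ K : Kato2004.MultDivisibilityInputsContra W 2
        (iwasawaToPowerSeries 2 (PowerSeries.C 5 * PowerSeries.X + PowerSeries.C 4) *
          padicLFunctionMinusBranchMult f (1 : ℚ_[2]) 1) κ γ I D',
      (∀ 𝔮 : PrimeSpectrum (IwasawaAlgebra 2), 𝔮.asIdeal.height = 1 →
          PowerSeries.C (2 : ℤ_[2]) ∉ 𝔮.asIdeal →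
          Module.lengthAt (IwasawaAlgebra 2) (IwasawaAlgebra 2 ⧸ LinearMap.range K.col) 𝔮 = 0) ∧
      (∀ 𝔮 : PrimeSpectrum (IwasawaAlgebra 2), 𝔮.asIdeal.height = 1 →
          PowerSeries.C (2 : ℤ_[2]) ∉ 𝔮.asIdeal →
          𝔮.asIdeal ≠ Ideal.span {(PowerSeries.C 5 * PowerSeries.X + PowerSeries.C 4 : IwasawaAlgebra 2)} →
          Module.lengthAt (IwasawaAlgebra 2) K.H2loc 𝔮 = 0) := by
  obtain ⟨I₂, D₂', eI, eD, heI, heD⟩ := hTw I D'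
  -- `Tw` as a ring automorphism of `Λ`
  set θ : IwasawaAlgebra 2 ≃+* IwasawaAlgebra 2 := unitTwistEquiv (-1) norm_neg_one_sub_one_lt_two with hθ
  have hθ_apply : ∀ r : IwasawaAlgebra 2, θ r = unitTwist r (-1) := fun r ↦ rfl
  -- the BACKWARD analytic transport of integral multiples: `(−Tw G)^ℚ = 2ⁿ·(5T+4)^ℚ·L⁻`
  have hL : ∀ (n : ℕ) (G : IwasawaAlgebra 2),
      iwasawaToPowerSeries 2 G = PowerSeries.C ((2 : ℚ_[2]) ^ n) *
        (iwasawaToPowerSeries 2 (PowerSeries.C 5 * PowerSeries.X + PowerSeries.C 6) *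
          padicLFunctionMinusBranchMultTwist f (1 : ℚ_[2]) 1 (-1)) →
        ∃ (n' : ℕ) (r : IwasawaAlgebra 2), iwasawaToPowerSeries 2 (r * θ G) = PowerSeries.C ((2 : ℚ_[2]) ^ n') *
          (iwasawaToPowerSeries 2 (PowerSeries.C 5 * PowerSeries.X + PowerSeries.C 4) *
            padicLFunctionMinusBranchMult f (1 : ℚ_[2]) 1) := by
    intro n G hG
    refine ⟨n, -1, ?_⟩
    rw [neg_one_mul, hθ_apply, map_neg]
    have h := (unitTwist_transport_of_split hsp hf 1).2 hG
    rw [unitTwist_neg_one_five_X_add_six, map_neg] at h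
    rw [h]
    ring
  have hp2 : PowerSeries.C ((2 : ℕ) : ℤ_[2]) = PowerSeries.C (2 : ℤ_[2]) := by norm_num
  -- the (−2)-block package at `W₂`, with `p = 2` written as `(2 : ℕ)`
  have hK₂' : ∃ K : Kato2004.MultDivisibilityInputsContra W₂ 2
      (iwasawaToPowerSeries 2 (PowerSeries.C 5 * PowerSeries.X + PowerSeries.C 6) *
        padicLFunctionMinusBranchMultTwist f (1 : ℚ_[2]) 1 (-1)) κ γ I₂ D₂',
      (∀ 𝔮 : PrimeSpectrum (IwasawaAlgebra 2), 𝔮.asIdeal.height = 1 →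
          PowerSeries.C ((2 : ℕ) : ℤ_[2]) ∉ 𝔮.asIdeal →
          Module.lengthAt (IwasawaAlgebra 2) (IwasawaAlgebra 2 ⧸ LinearMap.range K.col) 𝔮 = 0) ∧
      (∀ 𝔮 : PrimeSpectrum (IwasawaAlgebra 2), 𝔮.asIdeal.height = 1 →
          PowerSeries.C ((2 : ℕ) : ℤ_[2]) ∉ 𝔮.asIdeal →
          𝔮.asIdeal ≠ Ideal.span {(PowerSeries.C 5 * PowerSeries.X + PowerSeries.C 6 : IwasawaAlgebra 2)} →
          Module.lengthAt (IwasawaAlgebra 2) K.H2loc 𝔮 = 0) := by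
    obtain ⟨K, h1, h2⟩ := hK₂ I₂ D₂'
    exact ⟨K, fun 𝔮 h𝔮 hp ↦ h1 𝔮 h𝔮 (by rwa [hp2] at hp), fun 𝔮 h𝔮 hp hπ ↦ h2 𝔮 h𝔮 (by rwa [hp2] at hp) hπ⟩
  obtain ⟨K', h1', h2'⟩ :=
    Kato2004.exists_multDivisibilityInputsContra_of_semilinear_sideConditions θ eI heI eD heD hL
      (PowerSeries.C 5 * PowerSeries.X + PowerSeries.C 6) hK₂'
  refine ⟨K', fun 𝔮 h𝔮 hp ↦ h1' 𝔮 h𝔮 (by rwa [hp2]), fun 𝔮 h𝔮 hp hπ ↦ h2' 𝔮 h𝔮 (by rwa [hp2]) ?_⟩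
  rw [hθ_apply, unitTwist_neg_one_five_X_add_six, Ideal.span_singleton_neg]
  exact hπ

/-! ## §2 The `(−2)`-block avatar of a `(−1)`-block curve -/

/-- **The `(−2)`-block avatar.** Every elliptic `W/ℚ` has a globally minimal `W₂` and a change of variables `C` over `ℚ` with
`C • W₂ = W^{(2)}`, and for any such pair `W₂^{(−2)} = C′ • W^{(−1)}` for an explicit `C′`
(`(C₀ • W^{(2)})^{(−2)} = C″ • W^{(−4)}` and `W^{(−4)} = W^{(−1)·2²} ≅_ℚ W^{(−1)}`): hence `W₂^{(−2)}` is split multiplicative at `2`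
iff `W^{(−1)}` is, `W₂[2]` is irreducible iff `W[2]` is, and every newform of `W^{(−1)}` is a newform of `W₂^{(−2)}`.
[cite: SilvermanAEC2009, VIII.8 Cor. 8.3, X.2 Prop. 2.4, X.5 Cor. 5.4, VII.5 Prop. 5.1 (b), App. C §16] -/
theorem exists_negTwoAvatar_of_quadraticTwist_two (W : WeierstrassCurve ℚ) [W.IsElliptic] :
    ∃ (W₂ : WeierstrassCurve ℚ) (_ : W₂.IsElliptic) (_ : W₂.IsGloballyMinimal) (C : VariableChange ℚ),
      C • W₂ = W.quadraticTwist 2 ∧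
      ((W₂.quadraticTwist (-2)).HasSplitMultiplicativeReductionAtPrime 2 ↔
        (W.quadraticTwist (-1)).HasSplitMultiplicativeReductionAtPrime 2) ∧
      (W₂.HasIrreducibleModPGaloisRep 2 ↔ W.HasIrreducibleModPGaloisRep 2) ∧
      ∀ {N : ℕ} [NeZero N] (f : CuspForm (Gamma0 N) 2),
        IsNewformOf (W.quadraticTwist (-1)) f → IsNewformOf (W₂.quadraticTwist (-2)) f := by
  -- a globally minimal model `W₂` of `W^{(2)}`
  haveI hE2 : (W.quadraticTwist 2).IsElliptic := W.isElliptic_quadraticTwist two_ne_zero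
  obtain ⟨C₀, hC₀⟩ := hasGlobalMinimalModel_rat_holds (W.quadraticTwist 2)
  set W₂ : WeierstrassCurve ℚ := C₀ • W.quadraticTwist 2 with hW₂_def
  have hC : C₀⁻¹ • W₂ = W.quadraticTwist 2 := by rw [hW₂_def, inv_smul_smul]
  -- `W^{(−4)} ≅_ℚ W^{(−1)}` and `W₂^{(−2)} = C′ • W^{(−1)}`
  obtain ⟨C₂, hC₂⟩ := W.exists_variableChange_quadraticTwist_mul_sq (-1) (2 : ℚ) two_ne_zero
  have h4 : W.quadraticTwist (-4) = C₂ • W.quadraticTwist (-1) := by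
    rw [hC₂]; norm_num
  have htw : W₂.quadraticTwist (-2) =
      ((⟨C₀.u, -2 * C₀.r, 0, 0⟩ : VariableChange ℚ) * C₂) • W.quadraticTwist (-1) := by
    rw [hW₂_def, quadraticTwist_smul, quadraticTwist_quadraticTwist, mul_smul, ← h4]
    norm_num
  haveI hEm1 : (W.quadraticTwist (-1)).IsElliptic := W.isElliptic_quadraticTwist (by norm_num)
  refine ⟨W₂, inferInstance, hC₀, C₀⁻¹, hC, ?_, ?_, ?_⟩
  · -- split multiplicative reduction at `2` is a `ℚ`-isomorphism invariant
    rw [htw]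
    exact hasSplitMultiplicativeReductionAtPrime_smul_iff (W.quadraticTwist (-1)) _ 2
  · -- `W₂[2] ≅ W^{(2)}[2]`, irreducible iff `W[2]` is
    rw [hW₂_def, Mazur1978.hasIrreducibleModPGaloisRep_smul_iff, hasIrreducibleModPGaloisRep_quadraticTwist_iff W two_ne_zero]
  · -- `L(W₂^{(−2)}, s) = L(W^{(−1)}, s)`
    intro N _ f hf
    refine ⟨hf.1, fun n ↦ ?_⟩
    rw [hf.2 n, htw, LFunction_smul]

/-! ## §3 By name: the converse, and the equivalence of the two typed block inputs -/

/-- **The `(−2)`-block avatar of a `(−1)`-block curve with the `Tw`-identifications of both Kato carriers** — the hypothesis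
`hTw` of `negOnePackage_of_negTwoPackage_of_twTransport`, assembled: `W₂` := a globally minimal model of `W^{(2)}`
(`exists_negTwoAvatar_of_quadraticTwist_two`); `𝐇¹_Γ`-twin by `exists_iwasawaH1Data_negTwist_two` (this seat); `X(·/ℚ_∞)`-twin
keyed `γ⁻¹` by `AddSelmerTwistTwo.exists_twist_selmerDualData_two_inv` (seat t42 GEN 22). [cite: GreenbergLNM1716, §4 (p. 107)]
[cite: Rubin2000, Ch. VI §1–§2] [cite: SilvermanAEC2009, X.5 Cor. 5.4, VIII.8 Cor. 8.3] -/
theorem twTransport_of_negOneSplitTwist (W : WeierstrassCurve ℚ) [W.IsElliptic] [W.IsGloballyMinimal]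
    [ContinuousSMul ℤ_[2] (W.tateModule 2)]
    {N : ℕ} [NeZero N] (f : CuspForm (Gamma0 N) 2) (κ : ZpExtension ℚ 2) (γ : absoluteGaloisGroup ℚ)
    (hsp : (W.quadraticTwist (-1)).HasSplitMultiplicativeReductionAtPrime 2) (hirr : W.HasIrreducibleModPGaloisRep 2)
    (hκ : κ.IsCyclotomic) (hγ : κ.IsTopGenerator γ) (_hγ' : IsCyclotomicVariable 2 γ)
    (hf : IsNewformOf (W.quadraticTwist (-1)) f) :
    ∃ (W₂ : WeierstrassCurve ℚ) (_ : W₂.IsElliptic) (_ : W₂.IsGloballyMinimal)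
      (_ : ContinuousSMul ℤ_[2] (W₂.tateModule 2)),
      (W₂.quadraticTwist (-2)).HasSplitMultiplicativeReductionAtPrime 2 ∧ W₂.HasIrreducibleModPGaloisRep 2 ∧
      IsNewformOf (W₂.quadraticTwist (-2)) f ∧
      ∀ (I : Kato2004.IwasawaH1Data W 2 κ γ) (D' : W.SelmerDualData κ γ⁻¹),
        ∃ (I₂ : Kato2004.IwasawaH1Data W₂ 2 κ γ) (D₂' : W₂.SelmerDualData κ γ⁻¹)
          (eI : I₂.H ≃+ I.H) (eD : D₂'.X ≃+ D'.X),
          (∀ (r : IwasawaAlgebra 2) (h : I₂.H), eI (r • h) = unitTwist r (-1) • eI h) ∧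
          (∀ (r : IwasawaAlgebra 2) (x : D₂'.X), eD (r • x) = unitTwist r (-1) • eD x) := by
  obtain ⟨W₂, hE₂, hmin₂, C, hC, hsp_iff, hirr_iff, hnf⟩ := exists_negTwoAvatar_of_quadraticTwist_two W
  letI : ContinuousSMul ℤ_[2] (W₂.tateModule 2) := TateModule.continuousSMul_padicInt
  refine ⟨W₂, hE₂, hmin₂, inferInstance, hsp_iff.mpr hsp, hirr_iff.mpr hirr, hnf f hf, fun I D' ↦ ?_⟩
  obtain ⟨I₂, eI, heI⟩ := exists_iwasawaH1Data_negTwist_two W W₂ C hC κ γ hκ hγ I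
  obtain ⟨D₂', eD, heD, -⟩ := exists_twist_selmerDualData_two_inv κ hκ W W₂ hC hγ D'
  exact ⟨I₂, D₂', eI, eD, heI, fun r x ↦ heD r x⟩

/-- **The converse: `KatoOddBranchInputsAtTwoNegTwoSplitTwistPrintExact ⟹ KatoOddBranchInputsAtTwoNegOneSplitTwistPrintExact`**
with no further hypothesis. [cite: GreenbergLNM1716, §4 (p. 107)] [cite: Rubin2000, Ch. VI §1–§2]
[cite: Kato2004Asterisque, Thm. 12.5 with (12.5.1) (p. 222), §17.13 (pp. 279–280)] -/
theorem katoOddBranchInputsNegOnePrintExact_of_negTwo (hPE : KatoOddBranchInputsAtTwoNegTwoSplitTwistPrintExact) :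
    KatoOddBranchInputsAtTwoNegOneSplitTwistPrintExact := by
  intro W _ _ _ N _ f κ γ hsp hirr hκ hγ hγ' hf I D'
  obtain ⟨W₂, _, _, _, hsp₂, hirr₂, hf₂, hcar⟩ := twTransport_of_negOneSplitTwist W f κ γ hsp hirr hκ hγ hγ' hf
  exact negOnePackage_of_negTwoPackage_of_twTransport W W₂ f κ γ hsp hf
    (fun I₂ D₂' ↦ hPE W₂ f κ γ hsp₂ hirr₂ hκ hγ hγ' hf₂ I₂ D₂') hcar I D'

/-- **The two typed print-exact odd-branch inputs of C4″'s split-twist blocks are ONE object:**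
`KatoOddBranchInputsAtTwoNegOneSplitTwistPrintExact ↔ KatoOddBranchInputsAtTwoNegTwoSplitTwistPrintExact` (R15 kernel in both
directions). [cite: GreenbergLNM1716, §4 (p. 107)] [cite: Rubin2000, Ch. VI §1–§2]
[cite: Kato2004Asterisque, Thm. 12.5 with (12.5.1) (p. 222), §17.13 (pp. 279–280)] -/
theorem katoOddBranchInputsNegOnePrintExact_iff_negTwo :
    KatoOddBranchInputsAtTwoNegOneSplitTwistPrintExact ↔ KatoOddBranchInputsAtTwoNegTwoSplitTwistPrintExact :=
  ⟨katoOddBranchInputsNegTwoPrintExact_of_negOne, katoOddBranchInputsNegOnePrintExact_of_negTwo⟩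

end Summit.BirchSwinnertonDyer.BirchSwinnertonDyer.Theorems.AddKatoTwoGammaTwist

end
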